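import Mathlib.Analysis.Calculus.Deriv.MeanValue
import Mathlib.Analysis.Calculus.Deriv.Slope
import Mathlib.Analysis.SpecialFunctions.Log.Deriv
import Summits.NavierStokesRegularity.NavierStokesRegularity.Theorems.PerpetualPumpAveragedTypeIBlowupIvtNesting

/-!
# Crux `PerpetualPump.AveragedTypeIBlowup` (stmt-NavierStokesRegularity-1835), line `Sketch`:
# stub `logisticClock` — completion of the forced logistic clock `u' ≤ -R (1 - u²) + ψ`

This file proves the registered stub `stub_logisticClock` of the line skeleton
`Cruxes/AveragedTypeIBlowup/Lines/Sketch.lean`. In the transfer pulse of the line's seeded Toda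
circuit the normalised variable `u = (b - β) / R ∈ [-1, 1]` is a sub-solution of a forced logistic
clock `u' ≤ -R (1 - u²) + ψ` (`R > 0` a lower bound of the gate amplitude, `0 ≤ ψ ≤ R a₀ a₁ / 4` a
tiny forcing). The stub says that the clock COMPLETES: started at `u σ₀ ≤ 1 - a₀` it reaches the
level `-1 + a₁` at some time `σh ≤ σ₀ + (2/R) log (4 / (a₀ a₁))`, and from then on it can only
creep upwards at speed `ψ`: `u σ ≤ -1 + a₁ + ψ (σ - σh)` for `σ ∈ [σh, σ₁]`.

Proof (pure real analysis, Mathlib only; `u` is continuous on `[σ₀, σ₁]` and differentiable on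
the open interval, the standard shape of the mean value theorem).
* `logisticClock_image_sub_le` — mean value inequality from interior derivatives: `f' ≤ C` on
  `(a, b)` gives `f b - f a ≤ C (b - a)` (Lagrange).
* `logisticClock_deriv_nonneg_of_left_max` — if `f ≤ f s` on `[a, s)` and `f` is differentiable at
  `s`, then `0 ≤ f' s` (left difference quotients are `≥ 0`).
* `logisticClock_barrier` — the level `1 - a₀/2` is never exceeded on `[σ₀, σ₁]`: at a first
  crossing (`ivtNesting_exists_first_eq`) the derivative would be both `≥ 0` and
  `≤ -R (1 - (1 - a₀/2)²) + ψ ≤ -R a₀ / 2 < 0`.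
* `logisticClock_descent` — if `u > -1 + a₁` on the whole budget interval `[σ₀, σ*]`,
  `σ* = σ₀ + (2/R) log (4/(a₀ a₁))`, then `u` takes values in `(-1 + a₁, 1 - a₀/2] ⊂ (-1, 1)` there, so
  the potential `ℓ = artanh ∘ u = ½ (log (1 + u) - log (1 - u))` is continuous on `[σ₀, σ*]` with
  interior derivative `u' / (1 - u²) ≤ -R + ψ / (1 - u²) ≤ -R / 2` (as `1 - u² ≥ a₀ a₁ / 2`); hence
  `ℓ σ* ≤ ℓ σ₀ - log (4/(a₀ a₁))`, while `ℓ σ₀ ≤ ½ log ((2 - a₀)/a₀)` and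
  `ℓ σ* ≥ ½ log (a₁/(2 - a₁))` — impossible since `(2 - a₀)(2 - a₁) < 16`.
* `stub_logisticClock` — the hitting point `σh` of the descent, then the creep bound from
  `u' ≤ -R (1 - u²) + ψ ≤ ψ` (`|u| ≤ 1`) and the mean value inequality on `[σh, σ]`.

## References

* T. Tao, *Finite time blowup for an averaged three-dimensional Navier–Stokes equation*, J. Amer.
  Math. Soc. 29 (2016), 601–674, §5–6 (the logistic "pump/clock" comparison is folklore ODE).
-/

noncomputable section

-- the summit namespace `…NavierStokesRegularity.NavierStokesRegularity…` is the tree convention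
set_option linter.dupNamespace false

open Set Filter Topology

namespace Summit.NavierStokesRegularity.NavierStokesRegularity.Theorems.PerpetualPumpAveragedTypeIBlowup

/-- **Mean value inequality from interior derivatives.** If `f` is continuous on `[a, b]` and at
every point of `(a, b)` has a derivative `≤ C`, then `f b - f a ≤ C (b - a)` (Lagrange's mean value
theorem). [folklore] -/
theorem logisticClock_image_sub_le {f : ℝ → ℝ} {a b C : ℝ} (hab : a ≤ b)
    (hf : ContinuousOn f (Icc a b))
    (hf' : ∀ x ∈ Ioo a b, ∃ f' : ℝ, HasDerivAt f f' x ∧ f' ≤ C) :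
    f b - f a ≤ C * (b - a) := by
  rcases hab.eq_or_lt with rfl | hab'
  · simp
  obtain ⟨c, hc, hcd⟩ := exists_deriv_eq_slope f hab' hf
    (fun x hx => (hf' x hx).choose_spec.1.differentiableAt.differentiableWithinAt)
  obtain ⟨f', hfc, hle⟩ := hf' c hc
  rw [hfc.deriv] at hcd
  rw [hcd, div_le_iff₀ (sub_pos.2 hab')] at hle
  exact hle

/-- **Sign of the derivative at a left maximum.** If `a < s`, `f x ≤ f s` for all `x ∈ [a, s)` and
`f` has derivative `f'` at `s`, then `0 ≤ f'`: the difference quotients `(f x - f s)/(x - s)`,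
`x < s`, are nonnegative and tend to `f'`. [folklore] -/
theorem logisticClock_deriv_nonneg_of_left_max {f : ℝ → ℝ} {f' a s : ℝ} (has : a < s)
    (hf : HasDerivAt f f' s) (hmax : ∀ x ∈ Ico a s, f x ≤ f s) : 0 ≤ f' := by
  have ht : Tendsto (slope f s) (𝓝[<] s) (𝓝 f') :=
    (hasDerivAt_iff_tendsto_slope.1 hf).mono_left (nhdsLT_le_nhdsNE s)
  refine ge_of_tendsto ht ?_
  filter_upwards [Ico_mem_nhdsLT has] with x hx
  rw [slope_def_field]
  exact div_nonneg_of_nonpos (sub_nonpos.2 (hmax x hx)) (sub_neg.2 hx.2).le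

/-- **Upper barrier for the forced logistic clock.** A continuous `u` on `[σ₀, σ₁]` with
`u σ₀ ≤ 1 - a₀` and interior derivative `u' ≤ -R (1 - u²) + ψ`, `ψ ≤ R a₀ a₁ / 4 ≤ R a₀ / 4`, never
exceeds `1 - a₀/2` on `[σ₀, σ₁]`: at the first crossing of that level the derivative would be
nonnegative (`logisticClock_deriv_nonneg_of_left_max`) but the differential inequality forces it
below `-R a₀ / 2 < 0`. [folklore] -/
theorem logisticClock_barrier {u : ℝ → ℝ} {R ψ a₀ a₁ σ₀ σ₁ : ℝ} (hR : 0 < R) (ha₀ : 0 < a₀)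
    (ha₀1 : a₀ ≤ 1) (ha₁1 : a₁ ≤ 1) (hψR : ψ ≤ R * a₀ * a₁ / 4)
    (hu : ContinuousOn u (Icc σ₀ σ₁))
    (hder : ∀ σ ∈ Ioo σ₀ σ₁, ∃ u' : ℝ, HasDerivAt u u' σ ∧ u' ≤ -(R * (1 - (u σ) ^ 2)) + ψ)
    (h0 : u σ₀ ≤ 1 - a₀) : ∀ σ ∈ Icc σ₀ σ₁, u σ ≤ 1 - a₀ / 2 := by
  intro τ hτ
  by_contra! hcon
  obtain ⟨s, hs, hus, hbefore⟩ := ivtNesting_exists_first_eq hτ.1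
    (hu.mono (Icc_subset_Icc_right hτ.2)) (by linarith : u σ₀ ≤ 1 - a₀ / 2) hcon.le
  have hσ₀s : σ₀ < s := by
    rcases hs.1.eq_or_lt with h | h
    · rw [← h] at hus
      linarith
    · exact h
  have hsτ : s < τ := by
    rcases hs.2.eq_or_lt with h | h
    · rw [h] at hus
      linarith
    · exact h
  obtain ⟨u', hu', hle⟩ := hder s ⟨hσ₀s, hsτ.trans_le hτ.2⟩
  have hRa₀ : 0 < R * a₀ := mul_pos hR ha₀
  have hneg : u' < 0 := by
    rw [hus] at hle
    nlinarith [mul_le_mul_of_nonneg_left ha₁1 hRa₀.le, mul_le_mul_of_nonneg_left ha₀1 hRa₀.le]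
  have hnonneg : 0 ≤ u' :=
    logisticClock_deriv_nonneg_of_left_max hσ₀s hu'
      (fun x hx => by rw [hus]; exact (hbefore x hx).le)
  exact absurd hnonneg (not_le.2 hneg)

/-- **Descent of the forced logistic clock (the `artanh` potential).** Under the hypotheses of
`stub_logisticClock` (without the sign of `ψ` and the bound `|u| ≤ 1`, which are not needed here),
some `σh` in the budget interval `[σ₀, σ₀ + (2/R) log (4/(a₀ a₁))]` has `u σh ≤ -1 + a₁`. Otherwise
`u ∈ (-1 + a₁, 1 - a₀/2]` on that interval (`logisticClock_barrier`), the potential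
`ℓ = ½ (log (1 + u) - log (1 - u))` has interior derivative `u'/(1 - u²) ≤ -R/2`, so by the mean
value inequality `ℓ` drops by at least `log (4/(a₀ a₁))`, contradicting the endpoint bounds
`ℓ σ₀ ≤ ½ log ((2 - a₀)/a₀)`, `ℓ ≥ ½ log (a₁/(2 - a₁))` at the right end. [folklore] -/
theorem logisticClock_descent {u : ℝ → ℝ} {R ψ a₀ a₁ σ₀ σ₁ : ℝ} (hR : 0 < R) (ha₀ : 0 < a₀)
    (ha₀1 : a₀ ≤ 1) (ha₁ : 0 < a₁) (ha₁1 : a₁ ≤ 1) (hψR : ψ ≤ R * a₀ * a₁ / 4)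
    (hσ₁ : σ₀ + 2 / R * Real.log (4 / (a₀ * a₁)) ≤ σ₁)
    (hu : ContinuousOn u (Icc σ₀ σ₁))
    (hder : ∀ σ ∈ Ioo σ₀ σ₁, ∃ u' : ℝ, HasDerivAt u u' σ ∧ u' ≤ -(R * (1 - (u σ) ^ 2)) + ψ)
    (h0 : u σ₀ ≤ 1 - a₀) :
    ∃ σh ∈ Icc σ₀ (σ₀ + 2 / R * Real.log (4 / (a₀ * a₁))), u σh ≤ -1 + a₁ := by
  have hbar := logisticClock_barrier hR ha₀ ha₀1 ha₁1 hψR hu hder h0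
  set X : ℝ := Real.log (4 / (a₀ * a₁)) with hX
  have hX0 : 0 ≤ X := by
    refine Real.log_nonneg ((one_le_div (mul_pos ha₀ ha₁)).2 ?_)
    nlinarith [mul_le_mul_of_nonneg_left ha₁1 ha₀.le]
  have hσ₀s : σ₀ ≤ σ₀ + 2 / R * X :=
    le_add_of_nonneg_right (mul_nonneg (div_nonneg zero_le_two hR.le) hX0)
  by_contra! hcon
  have hsub : Icc σ₀ (σ₀ + 2 / R * X) ⊆ Icc σ₀ σ₁ := Icc_subset_Icc_right hσ₁
  have hp : ∀ σ ∈ Icc σ₀ (σ₀ + 2 / R * X), 0 < 1 + u σ := fun σ hσ => by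
    linarith [hcon σ hσ]
  have hq : ∀ σ ∈ Icc σ₀ (σ₀ + 2 / R * X), 0 < 1 - u σ := fun σ hσ => by
    linarith [hbar σ (hsub hσ)]
  -- the potential `ℓ = artanh ∘ u` is continuous on the closed budget interval …
  have hℓc : ContinuousOn (fun σ => 1 / 2 * (Real.log (1 + u σ) - Real.log (1 - u σ)))
      (Icc σ₀ (σ₀ + 2 / R * X)) := by
    have hu' := hu.mono hsub
    exact continuousOn_const.mul
      ((ContinuousOn.log (continuousOn_const.add hu') fun x hx => (hp x hx).ne').sub
        (ContinuousOn.log (continuousOn_const.sub hu') fun x hx => (hq x hx).ne'))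
  -- … and differentiable inside, with derivative `≤ -R/2`
  have hℓd : ∀ x ∈ Ioo σ₀ (σ₀ + 2 / R * X), ∃ ℓ' : ℝ,
      HasDerivAt (fun σ => 1 / 2 * (Real.log (1 + u σ) - Real.log (1 - u σ))) ℓ' x ∧
        ℓ' ≤ -(R / 2) := by
    intro x hx
    have hxI : x ∈ Icc σ₀ (σ₀ + 2 / R * X) := Ioo_subset_Icc_self hx
    obtain ⟨u', hu', hle⟩ := hder x ⟨hx.1, hx.2.trans_le hσ₁⟩
    have hpx := hp x hxI
    have hqx := hq x hxI
    have hp0 : 1 + u x ≠ 0 := hpx.ne'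
    have hq0 : 1 - u x ≠ 0 := hqx.ne'
    refine ⟨1 / 2 * (u' / (1 + u x) - -u' / (1 - u x)), ?_, ?_⟩
    · exact (((hu'.const_add 1).log hp0).sub ((hu'.const_sub 1).log hq0)).const_mul (1 / 2)
    · have hpq : a₀ * a₁ / 2 ≤ (1 + u x) * (1 - u x) := by
        have h1 : a₁ < 1 + u x := by linarith [hcon x hxI]
        have h2 : a₀ / 2 ≤ 1 - u x := by linarith [hbar x (hsub hxI)]
        rcases le_or_gt 0 (u x) with h | h
        · nlinarith [mul_nonneg h hqx.le, mul_le_mul_of_nonneg_left ha₁1 ha₀.le]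
        · nlinarith [mul_nonneg (neg_nonneg.2 h.le) hpx.le, mul_le_mul_of_nonneg_right ha₀1 ha₁.le]
      have key : 1 / 2 * (u' / (1 + u x) - -u' / (1 - u x)) = u' / ((1 + u x) * (1 - u x)) := by
        field_simp
        ring
      rw [key, div_le_iff₀ (mul_pos hpx hqx)]
      nlinarith [mul_le_mul_of_nonneg_left hpq hR.le]
  -- mean value inequality for the potential on the budget interval
  have hmv := logisticClock_image_sub_le hσ₀s hℓc hℓd
  have hs_mem : σ₀ + 2 / R * X ∈ Icc σ₀ (σ₀ + 2 / R * X) := right_mem_Icc.2 hσ₀s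
  have h0_mem : σ₀ ∈ Icc σ₀ (σ₀ + 2 / R * X) := left_mem_Icc.2 hσ₀s
  -- endpoint bounds of the potential
  have hℓ0 : 1 / 2 * (Real.log (1 + u σ₀) - Real.log (1 - u σ₀)) ≤
      1 / 2 * (Real.log (2 - a₀) - Real.log a₀) := by
    have h1 : Real.log (1 + u σ₀) ≤ Real.log (2 - a₀) :=
      Real.log_le_log (hp σ₀ h0_mem) (by linarith)
    have h2 : Real.log a₀ ≤ Real.log (1 - u σ₀) := Real.log_le_log ha₀ (by linarith)
    linarith
  have hℓs : 1 / 2 * (Real.log a₁ - Real.log (2 - a₁)) ≤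
      1 / 2 * (Real.log (1 + u (σ₀ + 2 / R * X)) - Real.log (1 - u (σ₀ + 2 / R * X))) := by
    have h1 : Real.log a₁ ≤ Real.log (1 + u (σ₀ + 2 / R * X)) :=
      Real.log_le_log ha₁ (by linarith [hcon _ hs_mem])
    have h2 : Real.log (1 - u (σ₀ + 2 / R * X)) ≤ Real.log (2 - a₁) :=
      Real.log_le_log (hq _ hs_mem) (by linarith [hcon _ hs_mem])
    linarith
  -- the time budget: `(R/2) · (2/R) log (4/(a₀ a₁)) = log 4 - log a₀ - log a₁`
  have hR0 : R ≠ 0 := hR.ne'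
  have htime : -(R / 2) * (σ₀ + 2 / R * X - σ₀) = -X := by
    field_simp
    ring
  have hXexp : X = Real.log 4 - (Real.log a₀ + Real.log a₁) := by
    rw [hX, Real.log_div (by norm_num) (mul_pos ha₀ ha₁).ne', Real.log_mul ha₀.ne' ha₁.ne']
  have hl1 : Real.log (2 - a₀) < Real.log 4 := Real.log_lt_log (by linarith) (by linarith)
  have hl2 : Real.log (2 - a₁) < Real.log 4 := Real.log_lt_log (by linarith) (by linarith)
  have hl3 : Real.log a₀ ≤ 0 := Real.log_nonpos ha₀.le ha₀1
  have hl4 : Real.log a₁ ≤ 0 := Real.log_nonpos ha₁.le ha₁1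
  rw [htime] at hmv
  linarith

/-- **Stub `logisticClock`** (Mathlib-only). COMPLETION OF THE FORCED LOGISTIC CLOCK: a continuous
`u : [σ₀, σ₁] → [-1, 1]` with `u σ₀ ≤ 1 - a₀` which is a sub-solution of `u' ≤ -R (1 - u²) + ψ` on
`(σ₀, σ₁)`, `0 < R`, `0 ≤ ψ ≤ R a₀ a₁ / 4`, `0 < a₀, a₁ ≤ 1`, reaches the level `-1 + a₁` at some
time `σh ∈ [σ₀, σ₀ + (2/R) log (4/(a₀ a₁))]` (provided this budget interval fits in `[σ₀, σ₁]`), and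
afterwards only creeps: `u σ ≤ -1 + a₁ + ψ (σ - σh)` on `[σh, σ₁]`. In the line's Toda circuit
`u = (b - β)/R` is the normalised transfer variable of the pulse. [folklore] -/
theorem stub_logisticClock :
    ∀ (u : ℝ → ℝ) (R ψ a₀ a₁ σ₀ σ₁ : ℝ), 0 < R → 0 ≤ ψ → 0 < a₀ → a₀ ≤ 1 → 0 < a₁ → a₁ ≤ 1 →
      ψ ≤ R * a₀ * a₁ / 4 → σ₀ + 2 / R * Real.log (4 / (a₀ * a₁)) ≤ σ₁ →
      ContinuousOn u (Icc σ₀ σ₁) → (∀ σ ∈ Icc σ₀ σ₁, |u σ| ≤ 1) →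
      (∀ σ ∈ Ioo σ₀ σ₁, ∃ u' : ℝ, HasDerivAt u u' σ ∧ u' ≤ -(R * (1 - (u σ) ^ 2)) + ψ) →
      u σ₀ ≤ 1 - a₀ →
      ∃ σh ∈ Icc σ₀ (σ₀ + 2 / R * Real.log (4 / (a₀ * a₁))), u σh ≤ -1 + a₁ ∧
        ∀ σ ∈ Icc σh σ₁, u σ ≤ -1 + a₁ + ψ * (σ - σh) := by
  intro u R ψ a₀ a₁ σ₀ σ₁ hR _hψ ha₀ ha₀1 ha₁ ha₁1 hψR hσ₁ hu habs hder h0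
  obtain ⟨σh, hσh, huh⟩ :=
    logisticClock_descent hR ha₀ ha₀1 ha₁ ha₁1 hψR hσ₁ hu hder h0
  refine ⟨σh, hσh, huh, ?_⟩
  intro σ hσ
  have hσ₀h : σ₀ ≤ σh := hσh.1
  -- on `(σh, σ)` the derivative is `≤ ψ` since `|u| ≤ 1`
  have hder' : ∀ x ∈ Ioo σh σ, ∃ u' : ℝ, HasDerivAt u u' x ∧ u' ≤ ψ := by
    intro x hx
    obtain ⟨u', hu', hle⟩ := hder x ⟨hσ₀h.trans_lt hx.1, hx.2.trans_le hσ.2⟩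
    have h1 := abs_le.1 (habs x ⟨hσ₀h.trans hx.1.le, hx.2.le.trans hσ.2⟩)
    have hsq : 0 ≤ R * (1 - u x ^ 2) := mul_nonneg hR.le (by nlinarith [h1.1, h1.2])
    exact ⟨u', hu', by linarith⟩
  have key := logisticClock_image_sub_le hσ.1 (hu.mono (Icc_subset_Icc hσ₀h hσ.2)) hder'
  linarith

end Summit.NavierStokesRegularity.NavierStokesRegularity.Theorems.PerpetualPumpAveragedTypeIBlowup
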